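import Summits.BirchSwinnertonDyer.BirchSwinnertonDyer.Theorems.PrintCf2RubinValueTwoLeopoldtDiagonalNorm
import Mathlib.FieldTheory.Normal.Basic
import HarnessLib

/-!
# M-LINE-PIN / (α3) ROW 2, FILE 2b: the product over COSET REPRESENTATIVES of `Gal(K̄/F)/Gal(K̄/F')` acting on `u ∈ F'` IS the norm
# `N_{F'/F} u` (`normOver F' F u`)

Cell `bsd-print-cf2`, WIDTH seat `bsd-line-cf2-p1-w6` g8 (prover-bsd-line-cf2-p1-w6-g8-0); (α3) ROW 2 on the DECIDING child stmt-BirchSwinnertonDyer-24721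
(memo `HOME/bsd-line-cf2-p1-w6/ROW2-SPEC-w6g8.md`, (R2-3b)); `--supports` that item (helper, Theses-free). HONEST FRAMING: Galois-theoretic bookkeeping;
nothing here closes the crux; no summit statement is proved by this seat; BSD is not proved by any of this. THEOREMS ONLY (no definition, no named
fact, no instance, no `sorry`).

WHAT. `Literature/…/GaloisRepresentations/KummerCorestrictionNorm` computes the corestriction of a Kummer cocycle as the Kummer cocycle of the
«norm element» `∏_{x ∈ G/N} s(x)·β` for coset representatives `s`; with `βⁿ = u` this element's `n`-th power is `∏ₓ s(x)·u`. This file identifies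
that product with the field norm used by the pins of Rubin's `UnitIndexData₂` ((U2): `normOver F_{n+1} F_n`): for intermediate fields
`F ≤ F'` of `K̄ = \bar k` with `F'/k` finite Galois, `H' = Gal(K̄/F) = galFixing k F ⊇ H = Gal(K̄/F') = galFixing k F'` and representatives `s` of
`H'/H`: **`∏ₓ s(x)·u = normOver F' F u`** for `u ∈ F'` (`prod_smul_eq_normOver`). Route: restriction `H' → (F' ≃ₐ[F] F')`
(`AlgEquiv.restrictNormal` made `F`-linear), which induces a bijection `H'/H ≃ Gal(F'/F)` (injective: equal restrictions differ by `H`;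
surjective: `AlgEquiv.liftNormal` through the normal `K̄/k`), and cf2c-w5's `LeopoldtAtV.algebraMap_norm_eq_normOver` + Mathlib
`Algebra.norm_eq_prod_automorphisms` (`N_{F'/F} u = ∏_{σ ∈ Gal(F'/F)} σ u`).

presearch: «norm as product over coset representatives of the Galois group» — Neukirch ANT Ch. I §2 / Lang Algebra VI §5 (folklore); tree:
`LeopoldtAtV.galOver_eq_range_restrictScalars`, `algebraMap_norm_eq_normOver`. beyond-print theorem: no.

References: S. Lang, *Algebra* (2002) VI §5 (norm = product of the distinct embeddings); J. Neukirch, *Algebraic Number Theory* (1999) Ch. IV §1.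
-/

noncomputable section

open scoped Classical

-- the summit namespace `Summit.BirchSwinnertonDyer.BirchSwinnertonDyer` repeats the problem name by design (D-0017)
set_option linter.dupNamespace false
set_option autoImplicit false

open Field IntermediateField
open Literature.NumberTheory.GaloisRepresentations Literature.NumberTheory.GaloisRepresentations.LocalWeilDatum
open Literature.NumberTheory.ComplexMultiplication.EllipticUnits
open Summit.BirchSwinnertonDyer.BirchSwinnertonDyer.Theorems.PrintCf2

namespace Summit.BirchSwinnertonDyer.BirchSwinnertonDyer.Theorems.PrintCf2.RowTwo

variable {k : Type} [Field k] {F F' : IntermediateField k (AlgebraicClosure k)}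

/-- An element of `Gal(K̄/F)` restricts to an `F`-AUTOMORPHISM of the normal `F' ≥ F`: the underlying `k`-automorphism is
`AlgEquiv.restrictNormal`, and it fixes `F` pointwise. Existence form (no definition): `∃ τ : F' ≃ₐ[F] F', ∀ u, ↑(τ u) = g • ↑u`.
[cite: NeukirchANT1999, Ch. IV §1 (1.1)] -/
theorem exists_algEquiv_coe_eq_smul (h : F ≤ F') [Normal k F'] (g : absoluteGaloisGroup k) (hg : g ∈ galFixing k F) :
    letI := (IntermediateField.inclusion h).toRingHom.toAlgebra
    ∃ τ : F' ≃ₐ[F] F', ∀ u : F', ((τ u : F') : AlgebraicClosure k) = g • (u : AlgebraicClosure k) := by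
  letI := (IntermediateField.inclusion h).toRingHom.toAlgebra
  let σ : F' ≃ₐ[k] F' := (absoluteGaloisGroup.toAlgEquiv k g).restrictNormal F'
  have hσ : ∀ u : F', ((σ u : F') : AlgebraicClosure k) = g • (u : AlgebraicClosure k) := fun u ↦
    AlgEquiv.restrictNormal_commutes (absoluteGaloisGroup.toAlgEquiv k g) F' u
  have hg' := hg
  rw [mem_galFixing_iff] at hg'
  refine ⟨AlgEquiv.ofRingEquiv (f := σ.toRingEquiv) fun c ↦ ?_, fun u ↦ hσ u⟩
  apply Subtype.ext
  change ((σ (IntermediateField.inclusion h c) : F') : AlgebraicClosure k) = ((IntermediateField.inclusion h c : F') : AlgebraicClosure k)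
  rw [hσ]
  exact hg' _ c.2

/-- **`∏_{x ∈ H'/H} s(x)·u = N_{F'/F}(u)`** for `u ∈ F'`, `F ≤ F' ⊆ K̄`, `F'/k` finite Galois, `H' = Gal(K̄/F) ⊇ H = Gal(K̄/F')`, and any system `s` of
representatives of `H'/H` (the norm is `normOver F' F`, the product of the `Gal(F'/F)`-conjugates). [cite: NeukirchANT1999, Ch. IV §1] -/
theorem prod_smul_eq_normOver (h : F ≤ F') [FiniteDimensional k F'] [IsGalois k F']
    [Fintype (↥(galFixing k F) ⧸ (galFixing k F').subgroupOf (galFixing k F))]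
    {s : ↥(galFixing k F) ⧸ (galFixing k F').subgroupOf (galFixing k F) → ↥(galFixing k F)}
    (hs : ∀ x, (s x : ↥(galFixing k F) ⧸ (galFixing k F').subgroupOf (galFixing k F)) = x) (u : F') :
    ∏ x, ((s x : galFixing k F) : absoluteGaloisGroup k) • (u : AlgebraicClosure k) =
      ((normOver F' F u : F') : AlgebraicClosure k) := by
  letI := (IntermediateField.inclusion h).toRingHom.toAlgebra
  haveI : IsScalarTower k F F' := LeopoldtAtV.isScalarTower_inclusion h
  haveI : FiniteDimensional F F' := Module.Finite.of_restrictScalars_finite k F F'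
  haveI : IsGalois F F' := IsGalois.tower_top_of_isGalois k F F'
  haveI : Normal k (AlgebraicClosure k) := IsAlgClosure.normal k (AlgebraicClosure k)
  -- the restriction of `g ∈ H'` to an `F`-automorphism of `F'`
  have hρ : ∀ g : galFixing k F, ∃ τ : F' ≃ₐ[F] F', ∀ u : F', ((τ u : F') : AlgebraicClosure k) =
      (g : absoluteGaloisGroup k) • (u : AlgebraicClosure k) := fun g ↦ exists_algEquiv_coe_eq_smul h g g.2
  choose ρ hρ using hρ
  -- `ρ` is constant on `H`-cosets exactly
  have hρeq : ∀ g g' : galFixing k F, ρ g = ρ g' ↔ ((g : absoluteGaloisGroup k))⁻¹ * (g' : absoluteGaloisGroup k) ∈ galFixing k F' := by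
    intro g g'
    rw [mem_galFixing_iff]
    constructor
    · intro hgg' x hx
      have h1 : (g : absoluteGaloisGroup k) • x = (g' : absoluteGaloisGroup k) • x := by
        rw [← hρ g ⟨x, hx⟩, ← hρ g' ⟨x, hx⟩, hgg']
      rw [mul_smul, ← h1, inv_smul_smul]
    · intro hfix
      ext v
      apply Subtype.ext_iff.mp ?_ |>.symm |> fun e ↦ e.symm
      apply Subtype.ext
      rw [hρ, hρ]
      have h2 := hfix (v : AlgebraicClosure k) v.2
      rw [mul_smul, inv_smul_eq_iff] at h2
      exact h2.symm
  -- the induced map on the quotient is a bijection onto `Gal(F'/F)`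
  let e : (↥(galFixing k F) ⧸ (galFixing k F').subgroupOf (galFixing k F)) → (F' ≃ₐ[F] F') := fun x ↦ ρ (s x)
  have hinj : Function.Injective e := by
    intro x y hxy
    have hmem : (s x)⁻¹ * s y ∈ (galFixing k F').subgroupOf (galFixing k F) := by
      rw [Subgroup.mem_subgroupOf, Subgroup.coe_mul, Subgroup.coe_inv]
      exact (hρeq (s x) (s y)).mp hxy
    rw [← hs x, ← hs y]
    exact QuotientGroup.eq.mpr hmem
  have hsurj : Function.Surjective e := by
    intro τ
    let γ : absoluteGaloisGroup k := (absoluteGaloisGroup.toAlgEquiv k).symm ((τ.restrictScalars k).liftNormal (AlgebraicClosure k))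
    have hγu : ∀ u : F', γ • (u : AlgebraicClosure k) = ((τ u : F') : AlgebraicClosure k) := fun u ↦
      AlgEquiv.liftNormal_commutes (τ.restrictScalars k) (AlgebraicClosure k) u
    have hγ : γ ∈ galFixing k F := by
      rw [mem_galFixing_iff]
      intro x hx
      have h1 := hγu (IntermediateField.inclusion h ⟨x, hx⟩)
      have h2 : τ (IntermediateField.inclusion h ⟨x, hx⟩) = IntermediateField.inclusion h ⟨x, hx⟩ := τ.commutes ⟨x, hx⟩
      rw [h2] at h1
      exact h1
    refine ⟨QuotientGroup.mk ⟨γ, hγ⟩, ?_⟩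
    -- `s [γ] ≡ γ` modulo `H`, so `ρ (s [γ]) = ρ γ = τ`
    have hmem : (s (QuotientGroup.mk ⟨γ, hγ⟩))⁻¹ * ⟨γ, hγ⟩ ∈ (galFixing k F').subgroupOf (galFixing k F) :=
      QuotientGroup.eq.mp (hs _)
    have h1 : ρ (s (QuotientGroup.mk ⟨γ, hγ⟩)) = ρ ⟨γ, hγ⟩ :=
      (hρeq _ _).mpr (by simpa [Subgroup.mem_subgroupOf] using hmem)
    change ρ (s (QuotientGroup.mk ⟨γ, hγ⟩)) = τ
    rw [h1]
    ext v
    exact Subtype.ext_iff.mp (Subtype.ext ((hρ ⟨γ, hγ⟩ v).trans (hγu v)) : (ρ ⟨γ, hγ⟩ v : F') = τ v)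
  -- the norm as the product of the conjugates
  rw [← LeopoldtAtV.algebraMap_norm_eq_normOver h u, Algebra.norm_eq_prod_automorphisms, IntermediateField.coe_prod]
  exact Fintype.prod_equiv (Equiv.ofBijective e ⟨hinj, hsurj⟩) _ _ fun x ↦ (hρ (s x) u).symm

end Summit.BirchSwinnertonDyer.BirchSwinnertonDyer.Theorems.PrintCf2.RowTwo

end
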